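import Summits.Ventures.HSemireg.WedgeHankelRecurrenceSchurCohn
import Summits.Ventures.HSemireg.WedgeHankelRecurrenceHurwitzStable

/-!
# Venture HSemireg — THE SCHUR–COHN THEOREM, ALGEBRAIC PROOF: for a complex polynomial `p` of degree `n` coprime with its reciprocal `p^♯ = Xⁿ p̄(1/X)` (no root `α` with `1/ᾱ` also a root, in particular
# none on the unit circle) the Schur–Cohn matrix `S_n(p)` (N193) is INVERTIBLE with **exactly `#{|z| < 1}` POSITIVE and `#{|z| > 1}` NEGATIVE eigenvalues** (roots of `p` inside ∕ outside the unit
# circle, with multiplicity); and unconditionally **`p` is a SCHUR polynomial (all roots in the open unit disc) iff `S_n(p) ≻ 0`** — the unit-circle companions of N184–N186, by the same root peeling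

HONEST FRAMING. Part of the Lean index of the computation cell `pub-hsemireg` (seat p10 gen 38, Sunday typer «UNIFORM-IN-n»).
LINEAR ALGEBRA OF HERMITIAN MATRICES AND COMPLEX POLYNOMIALS ONLY (Mathlib `Matrix.IsHermitian.eigenvalues`, `Matrix.PosDef`, `Polynomial.roots`; PROVED Literature `RectangularCongruenceInertia`
(Sylvester's law, direct sums) via N184's bookkeeping): no variety, no cohomology theory, no sheaf, no Ext group and no semiregularity map is constructed here; nothing here says that HC / HC_CM / HC_AV
holds; no Literature fact (unproved `Prop`) is declared or used.  Custodian versions as in `WedgeHankelSiegelIdeal` (1/3).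
SOURCE.  Classical theorem of I. Schur (1917/18) and A. Cohn (1922), Hermitian-form version of M. Fujiwara (1926) — CITED FROM MEMORY, NOT RE-READ (no held text states it; Fuhrmann–Helmke 2015 Def. 5.42
p0253 defines «Schur polynomial: roots only in `𝔻`»; S. Akiyama, N. Gjini, *Connectedness of number theoretical tilings* (DMTCS 2005, held `paper:doi-10-46298-dmtcs-353` p. 7) review «the Schur-Cohn
criterion to count the number of zeros inside/outside the unit circle» through Marden's *Geometry of Polynomials* §43–45, formulas lost in the held extraction).  The statements below are this
lineage's: `S_n(p) = B_n(p^♯, p)·J` (N193), inertia `(#{|z|<1}, #{|z|>1}, 0)` for `p ⊥ p^♯`, `S_n(p) ≻ 0 ⟺ p` Schur — all PROVED here.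
PROOF ROUTE (parallel to N184–N186).  N193's product rule packaged as ONE congruence `S_{n₁+n₂}(p₁p₂) = W (S(p₁) ⊕ S(p₂))^e Wᴴ`, `W = [C′ | C]`, `C′` multiplication by `p₂^♯` (`n₁` columns), `C`
by `p₁` (`n₂` columns); `W` invertible for `p₂^♯ ⊥ p₁`, `deg p₁ = n₁` (a Sylvester criterion with `deg p₂^♯ ≤ n₂` only); Sylvester's law (PROVED Literature) ⇒ inertia additivity; root peeling
`p = p₁(X − α)`, `(X − α)^♯ = 1 − ᾱX`, `S_1(X − α) = 1 − |α|²`, `|α| ≠ 1`; for «`S ≻ 0 ⇒` Schur» the kernel vector `(z₀^{n−1−j})_j` at a common root `z₀` of `p^♯, p` (N186's §852 transposed by `J`).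
DEDUP DISCLOSURE (`rg` of the whole tree + Mathlib, 2026-09-02): `SteinInertiaTheorem` (Literature) is the unit-circle inertia theorem for the Stein MATRIX equation (Lyapunov route), not used; N184–N186
are the half-plane versions.  19 names: 0 hits tree-wide (v3: the bookkeeping `(z̄)⁻¹ = z` on the unit circle is PROVED Literature `FejerRiesz.inv_conj_of_norm_eq_one` — caught by the gate dry-run
`dedup.landed`; inlined as a `have`, not restated).

WHAT IS IN THE TREE.  N193: `reciprocal`, `schurCohn`, `schurCohn_apply`, `schurCohn_isHermitian`, `schurCohn_mul_eq_add`, `reciprocal_mul`, `reciprocal_X_sub_C`, `reciprocal_natDegree_le`,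
`schurCohn_one_C_mul_X_sub_C`, `coeff_reciprocal`; N184: `fromCols_mulVec_apply`, `eq_zero_of_mul_add_mul_eq_zero_of_isCoprime`, `degree_mul_lt_of_degree_lt_of_natDegree_le`,
`card_eigenvalues_congr`, `card_eigenvalues_submatrix_equiv`; N185: `eigenvalues_fin_one` (+ Literature `HermiteRealRootedness.eval_map_conj` through N185's imports); N186: `sum_bezCoeff_mul_pow_eq_zero_of_isRoot`; N136: `coeff_sum_monomial_fin`,
`degree_sum_monomial_fin_lt`; Literature `RectangularCongruenceInertia`: `card_pos/neg_eigenvalues_mul_mul_conjTranspose_eq`, `card_eigenvalues_fromBlocks_zero_zero_eq_add`,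
`card_pos_add_card_neg_add_card_zero_eigenvalues`.  Mathlib: `Polynomial.eval₂_reflect_mul_pow`, `Complex.normSq`, `Complex.mul_conj`, `IsAlgClosed.exists_root`, `Polynomial.isCoprime_iff_aeval_ne_zero_of_isAlgClosed`.
THIS FILE (namespace `Summit.Ventures.HSemireg.Wedge.HankelOuter` continued; CHAINED on N193 + N186; 0 definitions):
* §871 `schurCohn_mul_eq_mul_fromBlocks_mul_conjTranspose` (the square congruence), `isUnit_det_fromCols_submatrix_of_isCoprime_of_le` (Sylvester criterion, `deg a ≤ n₂`, `deg b = n₁`, `b ≠ 0`),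
  **`card_pos_eigenvalues_schurCohn_mul`** ∕ **`card_neg_eigenvalues_schurCohn_mul`** (inertia additivity over coprime factors, `RCLike`).
* §872 OVER `ℂ`: `normSq_ne_one_of_isCoprime_reciprocal`, `card_eigenvalues_schurCohn_X_sub_C` (`S_1(X − α)`: `#{λ>0} = [‖α‖<1]`, `#{λ<0} = [‖α‖>1]`), `card_eigenvalues_schurCohn_aux` (the induction), **`card_pos_eigenvalues_schurCohn`** (`= #{z ∈ roots | ‖z‖ < 1}`), **`card_neg_eigenvalues_schurCohn`** (`= #{‖z‖ > 1}`),
  `isRoot_reciprocal_iff` (`a ≠ 0`: `p^♯(a) = 0 ⟺ p(ā⁻¹) = 0`), `norm_ne_one_of_isRoot`, `countP_norm_lt_add_countP_norm_gt`, **`card_zero_eigenvalues_schurCohn`**,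
  **`det_schurCohn_ne_zero`**.
* §873 SCHUR STABILITY: `schurCohn_mulVec_eq_zero_of_isRoot` (kernel vector at a common root of `p^♯, p`), `det_schurCohn_eq_zero_of_isRoot`, `isCoprime_reciprocal_of_det_ne_zero`,
  `isCoprime_reciprocal_of_forall_norm_lt_one`, **`posDef_schurCohn_iff`** (`deg p = n`: `S_n(p) ≻ 0 ⟺ ∀ z ∈ roots p, ‖z‖ < 1`).
CAVEATS.  Hypothesis `IsCoprime p (reciprocal n p)` for the counts (essential: `p = X² − 1`? roots `±1` on the circle, `S = 0`); the real (`ℝ[X]`, `sigPos`) reading and Jury-type determinant tests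
are successor leaves.  Nothing Ext-side.  New names only.
-/

open Module Polynomial
open scoped Matrix Polynomial ComplexConjugate ComplexOrder

namespace Summit.Ventures.HSemireg.Wedge.HankelOuter

open Summit.Ventures.HSemireg.Wedge Summit.Ventures.HSemireg.Wedge.Hankel
open Literature.LinearAlgebra.Matrix.Bezoutian (bezCoeff)

/-! ## §871. The square congruence, the Sylvester criterion (`deg a ≤ n₂`), inertia additivity -/

section Congruence

variable (K : Type*) [Field K] [StarRing K]

/-- **`S_{n₁+n₂}(p₁p₂) = W · (S_{n₁}(p₁) ⊕ S_{n₂}(p₂))^e · Wᴴ`** with `W = [C′ | C]^e`, `C′ = ((X^k p₂^♯)_i)_{k<n₁}`, `C = ((X^k p₁)_i)_{k<n₂}` (`deg pᵢ ≤ nᵢ`). [this file, §871] -/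
theorem schurCohn_mul_eq_mul_fromBlocks_mul_conjTranspose {n₁ n₂ : ℕ} {p₁ p₂ : K[X]} (h₁ : p₁.natDegree ≤ n₁) (h₂ : p₂.natDegree ≤ n₂) :
    schurCohn (n₁ + n₂) (p₁ * p₂)
      = (Matrix.fromCols (Matrix.of fun (i : Fin (n₁ + n₂)) (k : Fin n₁) => (Polynomial.X ^ (k : ℕ) * reciprocal n₂ p₂).coeff i)
            (Matrix.of fun (i : Fin (n₁ + n₂)) (k : Fin n₂) => (Polynomial.X ^ (k : ℕ) * p₁).coeff i)).submatrix id finSumFinEquiv.symm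
        * (Matrix.fromBlocks (schurCohn n₁ p₁) 0 0 (schurCohn n₂ p₂)).submatrix finSumFinEquiv.symm finSumFinEquiv.symm
        * ((Matrix.fromCols (Matrix.of fun (i : Fin (n₁ + n₂)) (k : Fin n₁) => (Polynomial.X ^ (k : ℕ) * reciprocal n₂ p₂).coeff i)
            (Matrix.of fun (i : Fin (n₁ + n₂)) (k : Fin n₂) => (Polynomial.X ^ (k : ℕ) * p₁).coeff i)).submatrix id finSumFinEquiv.symm)ᴴ := by
  rw [schurCohn_mul_eq_add K h₁ h₂, Matrix.conjTranspose_submatrix, Matrix.submatrix_mul_equiv, Matrix.submatrix_mul_equiv, Matrix.submatrix_id_id,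
    Matrix.fromCols_mul_fromBlocks, Matrix.conjTranspose_fromCols_eq_fromRows_conjTranspose, Matrix.fromCols_mul_fromRows, Matrix.mul_zero, Matrix.mul_zero, add_zero, zero_add]
  exact add_comm _ _

end Congruence

section Sylvester

variable (K : Type*) [Field K]

/-- **Sylvester criterion, relaxed: for `a ⊥ b` with `deg a ≤ n₂`, `deg b = n₁`, `b ≠ 0`, the square matrix `[C_a | C_b]^e` (`C_a`: `X^k a`, `k < n₁`; `C_b`: `X^k b`, `k < n₂`) is invertible** (N184's
criterion needed `deg a = n₂`; only `u·a + v·b = 0, deg u < deg b ⇒ u = v = 0` is used). [this file, §871] -/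
theorem isUnit_det_fromCols_submatrix_of_isCoprime_of_le {n₁ n₂ : ℕ} {a b : K[X]} (hab : IsCoprime a b) (ha : a.natDegree ≤ n₂) (hb : b.natDegree = n₁) (hb0 : b ≠ 0) :
    IsUnit ((Matrix.fromCols (Matrix.of fun (i : Fin (n₁ + n₂)) (k : Fin n₁) => (Polynomial.X ^ (k : ℕ) * a).coeff i)
      (Matrix.of fun (i : Fin (n₁ + n₂)) (k : Fin n₂) => (Polynomial.X ^ (k : ℕ) * b).coeff i)).submatrix id finSumFinEquiv.symm).det := by
  set W := Matrix.fromCols (Matrix.of fun (i : Fin (n₁ + n₂)) (k : Fin n₁) => (Polynomial.X ^ (k : ℕ) * a).coeff i)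
      (Matrix.of fun (i : Fin (n₁ + n₂)) (k : Fin n₂) => (Polynomial.X ^ (k : ℕ) * b).coeff i) with hW
  rw [← Matrix.isUnit_iff_isUnit_det, ← Matrix.mulVec_injective_iff_isUnit]
  suffices hker : ∀ d : Fin n₁ ⊕ Fin n₂ → K, W.mulVec d = 0 → d = 0 by
    intro c c' hcc'
    rw [← sub_eq_zero] at hcc' ⊢
    rw [← Matrix.mulVec_sub, Matrix.submatrix_mulVec_equiv, Equiv.symm_symm, Function.comp_id] at hcc'
    have h0 := hker _ hcc'
    funext j
    have := congrFun h0 (finSumFinEquiv.symm j)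
    simpa using this
  intro d hd
  set u : K[X] := ∑ k : Fin n₁, monomial (k : ℕ) (d (Sum.inl k)) with hu
  set v : K[X] := ∑ k : Fin n₂, monomial (k : ℕ) (d (Sum.inr k)) with hv
  have hud : u.degree < n₁ := degree_sum_monomial_fin_lt K n₁ _
  have hvd : v.degree < n₂ := degree_sum_monomial_fin_lt K n₂ _
  have hdeg : (u * a + v * b).degree < (n₁ + n₂ : ℕ) :=
    (Polynomial.degree_add_le _ _).trans_lt (max_lt (degree_mul_lt_of_degree_lt_of_natDegree_le K hud ha)
      (by rw [add_comm n₁ n₂]; exact degree_mul_lt_of_degree_lt_of_natDegree_le K hvd hb.le))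
  have hF : u * a + v * b = 0 := by
    refine Polynomial.ext fun m => ?_
    rw [Polynomial.coeff_zero]
    rcases Nat.lt_or_ge m (n₁ + n₂) with hm | hm
    · have := congrFun hd ⟨m, hm⟩
      rwa [hW, fromCols_mulVec_apply, Pi.zero_apply] at this
    · exact Polynomial.coeff_eq_zero_of_degree_lt (hdeg.trans_le (by exact_mod_cast hm))
  have hu0v0 : u = 0 ∧ v = 0 := eq_zero_of_mul_add_mul_eq_zero_of_isCoprime K hab (by rw [Polynomial.degree_eq_natDegree hb0, hb]; exact hud) hF
  funext s
  rcases s with k | k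
  · have := coeff_sum_monomial_fin K n₁ (fun k => d (Sum.inl k)) k
    rw [← hu, hu0v0.1, Polynomial.coeff_zero] at this
    exact this.symm
  · have := coeff_sum_monomial_fin K n₂ (fun k => d (Sum.inr k)) k
    rw [← hv, hu0v0.2, Polynomial.coeff_zero] at this
    exact this.symm

end Sylvester

section Inertia

variable {𝕜 : Type*} [RCLike 𝕜]

/-- **Inertia additivity for the Schur–Cohn matrix, positive index: `i₊(S_{n₁+n₂}(p₁p₂)) = i₊(S_{n₁}(p₁)) + i₊(S_{n₂}(p₂))`** for `deg p₁ = n₁`, `p₁ ≠ 0`, `deg p₂ ≤ n₂` and `p₂^♯ ⊥ p₁` (`ℝ` or `ℂ`).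
[this file, §871] -/
theorem card_pos_eigenvalues_schurCohn_mul {n₁ n₂ : ℕ} {p₁ p₂ : 𝕜[X]} (h₁ : p₁.natDegree = n₁) (h₁0 : p₁ ≠ 0) (h₂ : p₂.natDegree ≤ n₂) (hcop : IsCoprime (reciprocal n₂ p₂) p₁) :
    (Finset.univ.filter fun i => 0 < (schurCohn_isHermitian (show (p₁ * p₂).natDegree ≤ n₁ + n₂ from (Polynomial.natDegree_mul_le).trans (Nat.add_le_add h₁.le h₂))).eigenvalues i).card
      = (Finset.univ.filter fun i => 0 < (schurCohn_isHermitian h₁.le).eigenvalues i).card + (Finset.univ.filter fun i => 0 < (schurCohn_isHermitian h₂).eigenvalues i).card := by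
  have hD : (Matrix.fromBlocks (schurCohn n₁ p₁) 0 0 (schurCohn n₂ p₂)).IsHermitian := Matrix.IsHermitian.fromBlocks (schurCohn_isHermitian h₁.le) (by simp) (schurCohn_isHermitian h₂)
  have hDe : ((Matrix.fromBlocks (schurCohn n₁ p₁) 0 0 (schurCohn n₂ p₂)).submatrix (finSumFinEquiv (m := n₁) (n := n₂)).symm finSumFinEquiv.symm).IsHermitian := hD.submatrix _
  have hW := isUnit_det_fromCols_submatrix_of_isCoprime_of_le 𝕜 (n₁ := n₁) (n₂ := n₂) hcop (reciprocal_natDegree_le h₂) h₁ h₁0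
  rw [card_eigenvalues_congr (schurCohn_mul_eq_mul_fromBlocks_mul_conjTranspose 𝕜 h₁.le h₂) (schurCohn_isHermitian ((Polynomial.natDegree_mul_le).trans (Nat.add_le_add h₁.le h₂)))
      (Matrix.isHermitian_mul_mul_conjTranspose _ hDe) (0 < ·),
    Literature.LinearAlgebra.Matrix.card_pos_eigenvalues_mul_mul_conjTranspose_eq hDe hW, card_eigenvalues_submatrix_equiv hD finSumFinEquiv.symm hDe (0 < ·),
    Literature.LinearAlgebra.Matrix.card_eigenvalues_fromBlocks_zero_zero_eq_add (schurCohn_isHermitian h₁.le) (schurCohn_isHermitian h₂) hD (0 < ·)]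

/-- **Negative index: `i₋(S_{n₁+n₂}(p₁p₂)) = i₋(S_{n₁}(p₁)) + i₋(S_{n₂}(p₂))`** under the same hypotheses. [this file, §871] -/
theorem card_neg_eigenvalues_schurCohn_mul {n₁ n₂ : ℕ} {p₁ p₂ : 𝕜[X]} (h₁ : p₁.natDegree = n₁) (h₁0 : p₁ ≠ 0) (h₂ : p₂.natDegree ≤ n₂) (hcop : IsCoprime (reciprocal n₂ p₂) p₁) :
    (Finset.univ.filter fun i => (schurCohn_isHermitian (show (p₁ * p₂).natDegree ≤ n₁ + n₂ from (Polynomial.natDegree_mul_le).trans (Nat.add_le_add h₁.le h₂))).eigenvalues i < 0).card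
      = (Finset.univ.filter fun i => (schurCohn_isHermitian h₁.le).eigenvalues i < 0).card + (Finset.univ.filter fun i => (schurCohn_isHermitian h₂).eigenvalues i < 0).card := by
  have hD : (Matrix.fromBlocks (schurCohn n₁ p₁) 0 0 (schurCohn n₂ p₂)).IsHermitian := Matrix.IsHermitian.fromBlocks (schurCohn_isHermitian h₁.le) (by simp) (schurCohn_isHermitian h₂)
  have hDe : ((Matrix.fromBlocks (schurCohn n₁ p₁) 0 0 (schurCohn n₂ p₂)).submatrix (finSumFinEquiv (m := n₁) (n := n₂)).symm finSumFinEquiv.symm).IsHermitian := hD.submatrix _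
  have hW := isUnit_det_fromCols_submatrix_of_isCoprime_of_le 𝕜 (n₁ := n₁) (n₂ := n₂) hcop (reciprocal_natDegree_le h₂) h₁ h₁0
  rw [card_eigenvalues_congr (schurCohn_mul_eq_mul_fromBlocks_mul_conjTranspose 𝕜 h₁.le h₂) (schurCohn_isHermitian ((Polynomial.natDegree_mul_le).trans (Nat.add_le_add h₁.le h₂)))
      (Matrix.isHermitian_mul_mul_conjTranspose _ hDe) (· < 0),
    Literature.LinearAlgebra.Matrix.card_neg_eigenvalues_mul_mul_conjTranspose_eq hDe hW, card_eigenvalues_submatrix_equiv hD finSumFinEquiv.symm hDe (· < 0),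
    Literature.LinearAlgebra.Matrix.card_eigenvalues_fromBlocks_zero_zero_eq_add (schurCohn_isHermitian h₁.le) (schurCohn_isHermitian h₂) hD (· < 0)]

end Inertia

/-! ## §872. The Schur–Cohn theorem over `ℂ` -/

section Complex

/-- **`(X − α)^♯ ⊥ (X − α)` forces `|α| ≠ 1`** (`α` is a root of `1 − ᾱX` iff `ᾱα = 1`). [this file, §872] -/
theorem normSq_ne_one_of_isCoprime_reciprocal {α : ℂ} (h : IsCoprime (Polynomial.X - Polynomial.C α) (reciprocal 1 (Polynomial.X - Polynomial.C α))) : Complex.normSq α ≠ 1 := by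
  intro h1
  rw [Polynomial.isCoprime_iff_aeval_ne_zero_of_isAlgClosed (k := ℂ) (K := ℂ)] at h
  have h' := h α
  simp only [Polynomial.coe_aeval_eq_eval, reciprocal_X_sub_C, Polynomial.eval_sub, Polynomial.eval_X, Polynomial.eval_C, sub_self, ne_eq, not_true_eq_false, false_or, Polynomial.eval_one,
    Polynomial.eval_mul, Complex.star_def] at h'
  apply h'
  rw [← Complex.normSq_eq_conj_mul_self, h1, Complex.ofReal_one, sub_self]

/-- **`S_1(X − α)`: `#{λ > 0} = [‖α‖ < 1]` and `#{λ < 0} = [1 < ‖α‖]`** (its eigenvalue is `1 − |α|²`). [this file, §872] -/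
theorem card_eigenvalues_schurCohn_X_sub_C (α : ℂ) :
    (Finset.univ.filter fun i => 0 < (schurCohn_isHermitian (Polynomial.natDegree_X_sub_C α).le).eigenvalues i).card = (if ‖α‖ < 1 then 1 else 0)
      ∧ (Finset.univ.filter fun i => (schurCohn_isHermitian (Polynomial.natDegree_X_sub_C α).le).eigenvalues i < 0).card = (if 1 < ‖α‖ then 1 else 0) := by
  have hev : ∀ i, (schurCohn_isHermitian (Polynomial.natDegree_X_sub_C α).le).eigenvalues i = 1 - ‖α‖ ^ 2 := fun i => by
    rw [eigenvalues_fin_one]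
    have h1 := schurCohn_one_C_mul_X_sub_C (1 : ℂ) α 0 0
    rw [map_one, one_mul] at h1
    rw [h1, ← Complex.normSq_eq_norm_sq]
    simp [Complex.mul_conj, Complex.sub_re]
  simp_rw [hev]
  have hsq : ‖α‖ ^ 2 < 1 ↔ ‖α‖ < 1 := by constructor <;> intro h <;> nlinarith [norm_nonneg α]
  have hsq' : 1 < ‖α‖ ^ 2 ↔ 1 < ‖α‖ := by constructor <;> intro h <;> nlinarith [norm_nonneg α]
  constructor
  · by_cases h : ‖α‖ < 1
    · rw [if_pos h, Finset.filter_true_of_mem fun i _ => by linarith [hsq.2 h], Finset.card_univ, Fintype.card_fin]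
    · rw [if_neg h, Finset.filter_false_of_mem fun i _ => by intro h'; exact h (hsq.1 (by linarith)), Finset.card_empty]
  · by_cases h : 1 < ‖α‖
    · rw [if_pos h, Finset.filter_true_of_mem fun i _ => by linarith [hsq'.2 h], Finset.card_univ, Fintype.card_fin]
    · rw [if_neg h, Finset.filter_false_of_mem fun i _ => by intro h'; exact h (hsq'.1 (by linarith)), Finset.card_empty]

/-- **The induction**: for `deg p = n` and `p ⊥ p^♯`, `#{λ_i(S_n(p)) > 0} = #{z ∈ roots p | ‖z‖ < 1}` and `#{λ_i(S_n(p)) < 0} = #{z ∈ roots p | 1 < ‖z‖}` — peel a root `α`: `p = p₁(X − α)`,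
`S_n(p) ≅ S_{n−1}(p₁) ⊕ S_1(X − α)`, `S_1(X − α) = 1 − |α|²`, `|α| ≠ 1`. [this file, §872] -/
theorem card_eigenvalues_schurCohn_aux : ∀ (n : ℕ) (p : ℂ[X]) (hp : p.natDegree = n), IsCoprime p (reciprocal n p) →
    (Finset.univ.filter fun i => 0 < (schurCohn_isHermitian hp.le).eigenvalues i).card = p.roots.countP (fun z => ‖z‖ < 1)
      ∧ (Finset.univ.filter fun i => (schurCohn_isHermitian hp.le).eigenvalues i < 0).card = p.roots.countP (fun z => 1 < ‖z‖) := by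
  intro n
  induction n with
  | zero =>
    intro p hp _
    have hC := Polynomial.eq_C_of_natDegree_eq_zero hp
    have hroots : p.roots = 0 := by rw [hC, Polynomial.roots_C]
    simp [hroots]
  | succ n ih =>
    intro p hp hcop
    have hp0 : p ≠ 0 := by rintro rfl; simp at hp
    obtain ⟨α, hα⟩ : ∃ α, p.IsRoot α := IsAlgClosed.exists_root p (by rw [Polynomial.degree_eq_natDegree hp0, hp]; exact_mod_cast Nat.succ_ne_zero n)
    set p₁ := p /ₘ (Polynomial.X - Polynomial.C α) with hp₁
    have hfac : p = p₁ * (Polynomial.X - Polynomial.C α) := by rw [mul_comm]; exact (Polynomial.mul_divByMonic_eq_iff_isRoot.2 hα).symm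
    have hp₁0 : p₁ ≠ 0 := fun h0 => hp0 (by rw [hfac, h0, zero_mul])
    have hp₁d : p₁.natDegree = n := by
      have h := congrArg Polynomial.natDegree hfac
      rw [Polynomial.natDegree_mul hp₁0 (Polynomial.X_sub_C_ne_zero α), Polynomial.natDegree_X_sub_C, hp] at h
      omega
    -- coprimality of the pieces: `p^♯ = p₁^♯ · (X − α)^♯`
    have hrec : reciprocal (n + 1) p = reciprocal n p₁ * reciprocal 1 (Polynomial.X - Polynomial.C α) := by
      conv_lhs => rw [hfac]
      exact reciprocal_mul hp₁d.le (Polynomial.natDegree_X_sub_C α).le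
    have hcop' : IsCoprime (p₁ * (Polynomial.X - Polynomial.C α)) (reciprocal n p₁ * reciprocal 1 (Polynomial.X - Polynomial.C α)) := by
      rw [← hrec, ← hfac]; exact hcop
    have hcop₁ : IsCoprime p₁ (reciprocal n p₁) := hcop'.of_mul_left_left.of_mul_right_left
    have hcop₂ : IsCoprime (reciprocal 1 (Polynomial.X - Polynomial.C α)) p₁ := (hcop'.of_mul_left_left.of_mul_right_right).symm
    have hpos := card_pos_eigenvalues_schurCohn_mul (𝕜 := ℂ) hp₁d hp₁0 (Polynomial.natDegree_X_sub_C α).le hcop₂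
    have hneg := card_neg_eigenvalues_schurCohn_mul (𝕜 := ℂ) hp₁d hp₁0 (Polynomial.natDegree_X_sub_C α).le hcop₂
    obtain ⟨ihpos, ihneg⟩ := ih p₁ hp₁d hcop₁
    obtain ⟨h1pos, h1neg⟩ := card_eigenvalues_schurCohn_X_sub_C α
    have hroots : p.roots = p₁.roots + {α} := by
      conv_lhs => rw [hfac]
      rw [Polynomial.roots_mul (by rw [← hfac]; exact hp0), Polynomial.roots_X_sub_C]
    have hpd : (p₁ * (Polynomial.X - Polynomial.C α)).natDegree ≤ n + 1 := by rw [← hfac, hp]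
    constructor
    · rw [card_eigenvalues_congr (congrArg (schurCohn (n + 1)) hfac) (schurCohn_isHermitian hp.le) (schurCohn_isHermitian hpd) (0 < ·), hpos, ihpos, h1pos, hroots, Multiset.countP_add,
        ← Multiset.cons_zero, Multiset.countP_cons, Multiset.countP_zero, zero_add]
    · rw [card_eigenvalues_congr (congrArg (schurCohn (n + 1)) hfac) (schurCohn_isHermitian hp.le) (schurCohn_isHermitian hpd) (· < 0), hneg, ihneg, h1neg, hroots, Multiset.countP_add,
        ← Multiset.cons_zero, Multiset.countP_cons, Multiset.countP_zero, zero_add]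

/-- **THE SCHUR–COHN THEOREM, positive index: for `deg p = n` and `p ⊥ p^♯`, `S_n(p)` has exactly `#{z ∈ roots p | ‖z‖ < 1}` POSITIVE eigenvalues** (roots inside the unit circle, with multiplicity).
[this file, §872] -/
theorem card_pos_eigenvalues_schurCohn {n : ℕ} {p : ℂ[X]} (hp : p.natDegree = n) (hcop : IsCoprime p (reciprocal n p)) :
    (Finset.univ.filter fun i => 0 < (schurCohn_isHermitian hp.le).eigenvalues i).card = p.roots.countP (fun z => ‖z‖ < 1) :=
  (card_eigenvalues_schurCohn_aux n p hp hcop).1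

/-- **THE SCHUR–COHN THEOREM, negative index: `S_n(p)` has exactly `#{z ∈ roots p | 1 < ‖z‖}` NEGATIVE eigenvalues** (roots outside the unit circle). [this file, §872] -/
theorem card_neg_eigenvalues_schurCohn {n : ℕ} {p : ℂ[X]} (hp : p.natDegree = n) (hcop : IsCoprime p (reciprocal n p)) :
    (Finset.univ.filter fun i => (schurCohn_isHermitian hp.le).eigenvalues i < 0).card = p.roots.countP (fun z => 1 < ‖z‖) :=
  (card_eigenvalues_schurCohn_aux n p hp hcop).2

/-- `p^♯` at a point: **`p^♯(a) · … `: for `a ≠ 0`, `p^♯(a) = 0 ⟺ p((ā)⁻¹) = 0`** (`deg p ≤ n`; `p^♯(a) · (a⁻¹)ⁿ = p̄(a⁻¹) = \overline{p(ā⁻¹)}`, Mathlib `eval₂_reflect_mul_pow`). [this file, §872] -/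
theorem isRoot_reciprocal_iff {n : ℕ} {p : ℂ[X]} (hp : p.natDegree ≤ n) {a : ℂ} (ha : a ≠ 0) : (reciprocal n p).IsRoot a ↔ p.IsRoot (conj a)⁻¹ := by
  haveI : Invertible (a⁻¹) := invertibleOfNonzero (inv_ne_zero ha)
  have h := Polynomial.eval₂_reflect_mul_pow (RingHom.id ℂ) (a⁻¹) n (p.map (starRingEnd ℂ)) ((Polynomial.natDegree_map_le).trans hp)
  rw [Polynomial.eval₂_id, Polynomial.eval₂_id, invOf_eq_inv, inv_inv] at h
  rw [Polynomial.IsRoot, Polynomial.IsRoot, reciprocal, ← mul_left_inj' (pow_ne_zero n (inv_ne_zero ha)), zero_mul, h, Literature.Algebra.Polynomial.eval_map_conj, map_eq_zero_iff (starRingEnd ℂ) (RingHom.injective _),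
    map_inv₀]

/-- **No root on the unit circle: `p ⊥ p^♯` ⇒ every root `z` of `p` has `‖z‖ ≠ 1`.** [this file, §872] -/
theorem norm_ne_one_of_isRoot {n : ℕ} {p : ℂ[X]} (hp : p.natDegree ≤ n) (hcop : IsCoprime p (reciprocal n p)) {z : ℂ} (hz : p.IsRoot z) : ‖z‖ ≠ 1 := by
  intro h1
  have hz0 : z ≠ 0 := by rintro rfl; simp at h1
  rw [Polynomial.isCoprime_iff_aeval_ne_zero_of_isAlgClosed (k := ℂ) (K := ℂ)] at hcop
  rcases hcop z with h | h
  · exact h (by rwa [Polynomial.coe_aeval_eq_eval])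
  · refine h ?_
    -- on the unit circle `(z̄)⁻¹ = z` (PROVED in the tree as `Literature.Analysis.Fourier.FejerRiesz.inv_conj_of_norm_eq_one`; two lines, inlined to keep the imports light)
    have hinv : (conj z)⁻¹ = z := by
      have hn : Complex.normSq z = 1 := by rw [Complex.normSq_eq_norm_sq, h1, one_pow]
      rw [Complex.inv_def, Complex.conj_conj, Complex.normSq_conj, hn, inv_one, Complex.ofReal_one, mul_one]
    rw [Polynomial.coe_aeval_eq_eval, ← Polynomial.IsRoot, isRoot_reciprocal_iff hp hz0, hinv]
    exact hz

/-- **`#{‖z‖ < 1} + #{‖z‖ > 1} = n`** for `deg p = n`, `p ⊥ p^♯` (no root on the circle; `ℂ` algebraically closed). [this file, §872] -/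
theorem countP_norm_lt_add_countP_norm_gt {n : ℕ} {p : ℂ[X]} (hp : p.natDegree = n) (hcop : IsCoprime p (reciprocal n p)) :
    p.roots.countP (fun z => ‖z‖ < 1) + p.roots.countP (fun z => 1 < ‖z‖) = n := by
  have hcompl : p.roots.countP (fun z => 1 < ‖z‖) = p.roots.countP (fun z => ¬ ‖z‖ < 1) :=
    Multiset.countP_congr rfl fun z hz => by
      have hne := norm_ne_one_of_isRoot hp.le hcop ((Polynomial.mem_roots').1 hz).2
      exact propext ⟨fun h => not_lt.2 h.le, fun h => lt_of_le_of_ne (not_lt.1 h) (Ne.symm hne)⟩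
  rw [hcompl, ← Multiset.card_eq_countP_add_countP, IsAlgClosed.card_roots_eq_natDegree, hp]

/-- **THE SCHUR–COHN THEOREM, nullity: `S_n(p)` has NO zero eigenvalue** (`p ⊥ p^♯`, `deg p = n`). [this file, §872] -/
theorem card_zero_eigenvalues_schurCohn {n : ℕ} {p : ℂ[X]} (hp : p.natDegree = n) (hcop : IsCoprime p (reciprocal n p)) :
    (Finset.univ.filter fun i => (schurCohn_isHermitian hp.le).eigenvalues i = 0).card = 0 := by
  have h := Literature.LinearAlgebra.Matrix.card_pos_add_card_neg_add_card_zero_eigenvalues (schurCohn_isHermitian hp.le)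
  rw [card_pos_eigenvalues_schurCohn hp hcop, card_neg_eigenvalues_schurCohn hp hcop, countP_norm_lt_add_countP_norm_gt hp hcop, Fintype.card_fin] at h
  omega

/-- **THE SCHUR–COHN THEOREM, invertibility: `det S_n(p) ≠ 0`** (`p ⊥ p^♯`, `deg p = n`). [this file, §872] -/
theorem det_schurCohn_ne_zero {n : ℕ} {p : ℂ[X]} (hp : p.natDegree = n) (hcop : IsCoprime p (reciprocal n p)) : (schurCohn n p).det ≠ 0 := by
  rw [(schurCohn_isHermitian hp.le).det_eq_prod_eigenvalues, Finset.prod_ne_zero_iff]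
  intro i _ h0
  have h := card_zero_eigenvalues_schurCohn hp hcop
  rw [Finset.card_eq_zero, Finset.filter_eq_empty_iff] at h
  exact h (Finset.mem_univ i) (RCLike.ofReal_eq_zero.1 h0)

/-! ## §873. Schur stability ⟺ `S_n(p) ≻ 0` -/

/-- **A common root `z₀` of `p^♯` and `p` is a kernel vector of `S_n(p)`: `S_n(p) · (z₀^{n−1−j})_j = 0`** (`deg p ≤ n`; `B(p^♯, p)(z₀ʲ) = 0`, N186 §852, and `S = B·J`). [this file, §873] -/
theorem schurCohn_mulVec_eq_zero_of_isRoot {n : ℕ} {p : ℂ[X]} (hp : p.natDegree ≤ n) {z₀ : ℂ} (h₁ : (reciprocal n p).IsRoot z₀) (h₂ : p.IsRoot z₀) :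
    (schurCohn n p).mulVec (fun j : Fin n => z₀ ^ (n - 1 - (j : ℕ))) = 0 := by
  funext i
  rw [Matrix.mulVec, dotProduct, Pi.zero_apply]
  simp_rw [schurCohn_apply]
  calc ∑ j : Fin n, bezCoeff (reciprocal n p) p i (n - 1 - (j : ℕ)) * z₀ ^ (n - 1 - (j : ℕ))
      = ∑ j : Fin n, bezCoeff (reciprocal n p) p i (j : ℕ) * z₀ ^ (j : ℕ) := by
        rw [← Equiv.sum_comp Fin.revPerm]
        exact Finset.sum_congr rfl fun j _ => by rw [Fin.revPerm_apply, Fin.val_rev, show n - 1 - (n - ((j : ℕ) + 1)) = j by omega]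
    _ = ∑ j ∈ Finset.range n, bezCoeff (reciprocal n p) p i j * z₀ ^ j := Fin.sum_univ_eq_sum_range (fun j => bezCoeff (reciprocal n p) p i j * z₀ ^ j) n
    _ = 0 := sum_bezCoeff_mul_pow_eq_zero_of_isRoot (reciprocal_natDegree_le hp) hp h₁ h₂ i.isLt

/-- **Hence `det S_n(p) = 0` whenever `p^♯` and `p` have a common root** (`n ≥ 1`). [this file, §873] -/
theorem det_schurCohn_eq_zero_of_isRoot {n : ℕ} {p : ℂ[X]} (hp : p.natDegree ≤ n + 1) {z₀ : ℂ} (h₁ : (reciprocal (n + 1) p).IsRoot z₀) (h₂ : p.IsRoot z₀) :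
    (schurCohn (n + 1) p).det = 0 := by
  refine (Matrix.exists_mulVec_eq_zero_iff).1 ⟨fun j : Fin (n + 1) => z₀ ^ (n + 1 - 1 - (j : ℕ)), fun h => ?_, schurCohn_mulVec_eq_zero_of_isRoot hp h₁ h₂⟩
  have := congrFun h (Fin.last n)
  simp at this

/-- **`det S_n(p) ≠ 0` forces `p ⊥ p^♯`** (`deg p = n`, `p ≠ 0`). [this file, §873] -/
theorem isCoprime_reciprocal_of_det_ne_zero {n : ℕ} {p : ℂ[X]} (hp : p.natDegree = n) (hp0 : p ≠ 0) (hdet : (schurCohn n p).det ≠ 0) : IsCoprime p (reciprocal n p) := by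
  rw [Polynomial.isCoprime_iff_aeval_ne_zero_of_isAlgClosed (k := ℂ) (K := ℂ)]
  intro w
  by_contra h
  simp only [Polynomial.coe_aeval_eq_eval, not_or, ne_eq, not_not] at h
  obtain ⟨m, rfl⟩ : ∃ m, n = m + 1 := by
    refine Nat.exists_eq_add_one.2 (Nat.pos_of_ne_zero fun hn => ?_)
    rw [hn] at hp
    rw [Polynomial.eq_C_of_natDegree_eq_zero hp, Polynomial.eval_C] at h
    exact hp0 (by rw [Polynomial.eq_C_of_natDegree_eq_zero hp, h.1, map_zero])
  exact hdet (det_schurCohn_eq_zero_of_isRoot hp.le h.2 h.1)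

/-- **A Schur polynomial is coprime with its reciprocal**: a common root `z` of `p` and `p^♯` would have `‖z‖ < 1` and, being `(ā)⁻¹` for a root `a`, `‖z‖ > 1`. [this file, §873] -/
theorem isCoprime_reciprocal_of_forall_norm_lt_one {n : ℕ} {p : ℂ[X]} (hp : p.natDegree = n) (hp0 : p ≠ 0) (h : ∀ z ∈ p.roots, ‖z‖ < 1) : IsCoprime p (reciprocal n p) := by
  rw [Polynomial.isCoprime_iff_aeval_ne_zero_of_isAlgClosed (k := ℂ) (K := ℂ)]
  intro a
  by_contra hcon
  simp only [Polynomial.coe_aeval_eq_eval, not_or, ne_eq, not_not] at hcon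
  have ha : ‖a‖ < 1 := h a ((Polynomial.mem_roots hp0).2 hcon.1)
  rcases eq_or_ne a 0 with rfl | ha0
  · -- `p^♯(0) = conj (p_n) ≠ 0`
    have h0 := hcon.2
    rw [← Polynomial.coeff_zero_eq_eval_zero, coeff_reciprocal, Polynomial.revAt_le (Nat.zero_le n), Nat.sub_zero, ← hp, Polynomial.coeff_natDegree, star_eq_zero, Polynomial.leadingCoeff_eq_zero] at h0
    exact hp0 h0
  · have hb : p.IsRoot (conj a)⁻¹ := (isRoot_reciprocal_iff hp.le ha0).1 hcon.2
    have hb' := h _ ((Polynomial.mem_roots hp0).2 hb)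
    rw [norm_inv, Complex.norm_conj] at hb'
    have : 1 < ‖a‖⁻¹ := one_lt_inv_iff₀.2 ⟨norm_pos_iff.2 ha0, ha⟩
    linarith

/-- **SCHUR STABILITY BY THE SCHUR–COHN MATRIX: a complex polynomial `p` of degree `n` has ALL its roots in the open unit disc iff `S_n(p)` is positive definite** (⇒: Schur ⇒ coprime ⇒ `#{λ > 0} =
#{‖z‖ < 1} = n`; ⇐: `det ≠ 0` ⇒ coprime ⇒ `#{‖z‖ < 1} = #{λ > 0} = n`).  For `p = 0` both sides hold vacuously. [this file, §873] -/
theorem posDef_schurCohn_iff {n : ℕ} {p : ℂ[X]} (hp : p.natDegree = n) : (schurCohn n p).PosDef ↔ ∀ z ∈ p.roots, ‖z‖ < 1 := by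
  rcases eq_or_ne p 0 with rfl | hp0
  · rw [Polynomial.natDegree_zero] at hp; subst hp
    simp only [Polynomial.roots_zero, Multiset.notMem_zero, IsEmpty.forall_iff, implies_true, iff_true]
    exact (schurCohn_isHermitian (p := (0 : ℂ[X])) (by simp)).posDef_iff_eigenvalues_pos.2 fun i => i.elim0
  have hcard : p.roots.card = n := by rw [IsAlgClosed.card_roots_eq_natDegree, hp]
  rw [(schurCohn_isHermitian hp.le).posDef_iff_eigenvalues_pos]
  constructor
  · intro hpos
    have hdet : (schurCohn n p).det ≠ 0 := by
      rw [(schurCohn_isHermitian hp.le).det_eq_prod_eigenvalues, Finset.prod_ne_zero_iff]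
      exact fun i _ => (RCLike.ofReal_ne_zero).2 (hpos i).ne'
    have hcop := isCoprime_reciprocal_of_det_ne_zero hp hp0 hdet
    have hcount := card_pos_eigenvalues_schurCohn hp hcop
    rw [Finset.filter_true_of_mem fun i _ => hpos i, Finset.card_univ, Fintype.card_fin, ← hcard] at hcount
    exact Multiset.countP_eq_card.1 hcount.symm
  · intro h i
    have hcop := isCoprime_reciprocal_of_forall_norm_lt_one hp hp0 h
    have hcount := card_pos_eigenvalues_schurCohn hp hcop
    rw [Multiset.countP_eq_card.2 h, hcard] at hcount
    have hall : (Finset.univ.filter fun i => 0 < (schurCohn_isHermitian hp.le).eigenvalues i) = Finset.univ :=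
      Finset.eq_univ_of_card _ (by rw [hcount, Fintype.card_fin])
    have := Finset.mem_univ i
    rw [← hall, Finset.mem_filter] at this
    exact this.2

end Complex

end Summit.Ventures.HSemireg.Wedge.HankelOuter
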